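import Summits.BirchSwinnertonDyer.BirchSwinnertonDyer.Theorems.QuadraticBranchSignedControlPlusEtaR1KuriharaRows01
import Summits.BirchSwinnertonDyer.BirchSwinnertonDyer.Theorems.QuadraticBranchSignedControlPlusEtaR0KuriharaKRows02
import Summits.BirchSwinnertonDyer.BirchSwinnertonDyer.Theorems.QuadraticBranchSignedControlPlusEtaR0KuriharaKRows03
import Summits.BirchSwinnertonDyer.BirchSwinnertonDyer.Theorems.QuadraticBranchSignedControlPlusEtaR0KuriharaKRows04
import Summits.BirchSwinnertonDyer.BirchSwinnertonDyer.Theorems.QuadraticBranchSignedControlPlusEtaR0KuriharaKRows05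
import Summits.BirchSwinnertonDyer.BirchSwinnertonDyer.Theorems.QuadraticBranchSignedControlPlusEtaR1KuriharaLambdaRows06
import Summits.BirchSwinnertonDyer.BirchSwinnertonDyer.Theorems.QuadraticBranchSignedControlPlusEtaKuriharaRecordsLocalTorsion01
import HarnessLib

/-!
# Route `QuadraticBranchSignedControl` (rung K8, cell `bsd-potss`), crux `PlusEtaLowerInclusion`
# (item stmt-BirchSwinnertonDyer-19601): the Kurihara-road records with the local binder
# `ht0 : #W(ℚ_p)[p] = 1` DISCHARGED IN THE KERNEL — part 2: the 13 RANK-ZERO records (a `--supports` file;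
# seat `bsd-potss-k8eta-c1`, gen 7)

WHAT. Every Kurihara-road record of the crux landed by this seat's gens 6 (`…PlusEtaR1KuriharaRows01`,
`…PlusEtaR0KuriharaKRows02–05`, `…PlusEtaR1KuriharaLambdaRows06`: 17 rows — the 2 Tamagawa-free
height-defect rank-one rows, the 13 Tamagawa-free rank-zero rows, 2 λ-rows) displays, next to the named
inputs `hKim` (Kim 2026 Thm. 1.11 (1) ⟹ (3) read at `η`) and Cremona's Manin data (`h300`/`h500`) and
the data binders `hopt`/`hδ`, the LOCAL binder
`ht0 : Nat.card {Q ∈ W(ℚ_p) // p • Q = O} = 1` — Thm. 1.11's hypothesis `E(ℚ_p)[p] = 0` for the additive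
partner `E := W` — "automatic in theory (potentially good supersingular, `e = 2 < p − 1`) but not
kernel-certifiable by the tree's `ψ_p` certificate on the singular residue disc" (gen 6 memo v3 §A).
The new Literature theorem `natCard_localPTorsion_eq_one_of_twist_of_supersingular`
(`Literature/NumberTheory/EllipticCurves/LocalTorsionSupersingularTwistProofs.lean`, this seat: a
`ℚ_p`-rational `p`-torsion abscissa of `W` would transport to a `ℚ_p`-rational root of `ψ_p(V)`, whose
Newton polygon at a supersingular `p` is one segment of slope `2/(p² − 1)`) makes it a THEOREM for every
model `W` of a quadratic twist of a good supersingular curve. Part 1 (`…PlusEtaKuriharaRecordsLocalTorsion01`) holds the bookkeeping lemma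
`PlusEtaKuriharaT0.etaPair_of_localTorsion`, the road by name and the 4 rank-one records; THIS FILE (part 2)
re-issues the 13 rank-zero records (`…PlusEtaR0KuriharaKRows02–05`) WITHOUT `ht0`. Overview of both parts:

* §1 `etaPair_of_localTorsion` — bookkeeping: the binder is discharged INSIDE the two node conclusions
  (which carry `p ≠ 2`, `V.HasGoodReductionAtPrime p`, `V.frobeniusTrace p = 0` as their own binders), so a
  record stated «for every model `V` of `W^{(d)}`, no `V`-side certificate» keeps exactly that shape;
  `etaPair_of_thm111_of_kuriharaUnit` — the Kurihara road BY NAME (gen 6's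
  `PlusEtaR1Kurihara.etaPair_of_thm111_of_kuriharaUnit`) with `ht0` removed;
* §2 the 17 records `etaPair_r{0,1}_kur[K]_v<label>_<p>` of namespace `…Theorems.PlusEtaKuriharaT0`, each
  `=` the landed record of the same name fed with the discharged binder. Trust base per record AFTER this
  file: {`hKim` (p534181), Cremona's Manin datum (`h300`/`h500`), `hopt`, `hδ` (unit Kurihara number:
  kit j279367 / j260432 / j261654 / j283615, two engines on the r1 rows)} — `ht0` is gone.

HONEST LABEL: per-row instances CONDITIONAL on the named fact `hKim` and the displayed `hopt`/`hδ`; the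
class-wide crux 19601 stays OPEN (Kato's lower inclusion for the additive twist, in print for no non-CM
`V`); nothing is booked; `BSD(W, p)` is claimed for no row; BSD is not proved by any of this.
TALLY of the 40 tower-onto census rows (unchanged): r0 19/19, r1 20/21, residue `69150v1`.

References: [Kim2022StructureSelmer] Thm. 1.11 (PDF p. 8), Prop. 3.2 (PDF p. 15), §6 (PDF p. 31);
[Kobayashi2003] §4 (p. 8), proof of Thm. 7.4 (p. 13); [Serre1972] §1.11 Prop. 12.
-/

set_option autoImplicit false
-- sibling precedent (`…PlusEtaR1KuriharaRows01.lean`): the directory name repeats the summit name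
set_option linter.dupNamespace false

noncomputable section

open scoped Classical

namespace Summit.BirchSwinnertonDyer.BirchSwinnertonDyer.Theorems.PlusEtaKuriharaT0

open CongruenceSubgroup WeierstrassCurve Field Literature.NumberTheory.EllipticCurves
  Literature.NumberTheory.EllipticCurves.ModularForms
  Literature.NumberTheory.GaloisRepresentations
  Literature.NumberTheory.EllipticCurves.Rank1Residual
  Literature.NumberTheory.EllipticCurves.Rank1Residual.Typed
  Summit.BirchSwinnertonDyer.Rank1Residual
  Summit.BirchSwinnertonDyer.BirchSwinnertonDyer.Theorems

open Summit.BirchSwinnertonDyer.Rank1Residual.Additive hiding EtaSignedSelmerDualData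
  IsQuadraticBranchPlusLFunction IsQuadraticBranchMinusLFunction

/-! ## §2 (continued) The 13 rank-zero records of `…PlusEtaR0KuriharaKRows02–05`, `ht0` discharged -/

/-- **Record r0 row `80550g1` (n = 61·181), `ht0` DISCHARGED**: the landed `PlusEtaR0KuriharaK.etaPair_r0_kurK_v80550g1_5` with its local binder
`ht0 : #W(ℚ_5)[5] = 1` supplied by `natCard_localPTorsion_eq_one_of_twist_of_supersingular` inside the
nodes; trust base now {`hKim`, `h300`, `hopt`, `hδ`}. For EVERY model `V` of `W^{(5)}`: (E⁺_η) at `5`,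
(C1⁺_η) under the onto tower. CONDITIONAL; per-row instance; nothing booked; `BSD(W,5)` not claimed.
[cite: Kim2022StructureSelmer, Thm. 1.11 (PDF p. 8), Prop. 3.2 (PDF p. 15)] [cite: Kobayashi2003, §4 (p. 8)] -/
theorem etaPair_r0_kurK_v80550g1_5
    (hKim : Kim2026.thm111_etaEisensteinInclusion_of_kuriharaNumber_ne_zero)
    (h300 : cremona_abs_maninConstant_eq_one_of_level_le_300000)
    (W : WeierstrassCurve ℚ) (hW : W = ⟨1, -1, 0, -16515117, -25828618959⟩)
    (D : ModularParametrizationData W 80550)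
    (hopt : ∀ z ∈ D.L.lattice, ∃ w ∈ periodLattice D.f, z = D.c * w)
    (hδ : ∃ ψ : (ℓ : ℕ) → (ZMod ℓ)ˣ →* Multiplicative (ZMod 5),
      (∀ ℓ ∈ (61 * 181 : ℕ).primeFactors, Function.Surjective (ψ ℓ)) ∧ kuriharaNumber D.f 5 (61 * 181) ψ ≠ 0)
    (V : WeierstrassCurve ℚ) [V.IsElliptic] [V.IsGloballyMinimal] [hp : Fact (5 : ℕ).Prime]
    (C : VariableChange ℚ) (hCV : C • W.quadraticTwist 5 = V) :
    QuadraticBranchPlusEtaLowerInclusionAt V 5 ∧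
      ((∀ m : ℕ, V.HasSurjectiveModNGaloisRep (5 ^ m : ℕ)) → QuadraticBranchPlusEtaMainConjectureAt V 5) := by
  haveI : W.IsElliptic := hW ▸ PlusEtaR0Kurihara.isElliptic_v80550g1
  exact etaPair_of_localTorsion W C (by norm_num) hCV fun ht0 ↦
    PlusEtaR0KuriharaK.etaPair_r0_kurK_v80550g1_5 hKim h300 W hW D hopt ht0 hδ V C hCV

/-- **Record r0 row `137775i1` (n = 191·241), `ht0` DISCHARGED**: the landed `PlusEtaR0KuriharaK.etaPair_r0_kurK_v137775i1_5` with its local binder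
`ht0 : #W(ℚ_5)[5] = 1` supplied by `natCard_localPTorsion_eq_one_of_twist_of_supersingular` inside the
nodes; trust base now {`hKim`, `h300`, `hopt`, `hδ`}. For EVERY model `V` of `W^{(5)}`: (E⁺_η) at `5`,
(C1⁺_η) under the onto tower. CONDITIONAL; per-row instance; nothing booked; `BSD(W,5)` not claimed.
[cite: Kim2022StructureSelmer, Thm. 1.11 (PDF p. 8), Prop. 3.2 (PDF p. 15)] [cite: Kobayashi2003, §4 (p. 8)] -/
theorem etaPair_r0_kurK_v137775i1_5
    (hKim : Kim2026.thm111_etaEisensteinInclusion_of_kuriharaNumber_ne_zero)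
    (h300 : cremona_abs_maninConstant_eq_one_of_level_le_300000)
    (W : WeierstrassCurve ℚ) (hW : W = ⟨1, 1, 0, -1514700, -718156125⟩)
    (D : ModularParametrizationData W 137775)
    (hopt : ∀ z ∈ D.L.lattice, ∃ w ∈ periodLattice D.f, z = D.c * w)
    (hδ : ∃ ψ : (ℓ : ℕ) → (ZMod ℓ)ˣ →* Multiplicative (ZMod 5),
      (∀ ℓ ∈ (191 * 241 : ℕ).primeFactors, Function.Surjective (ψ ℓ)) ∧ kuriharaNumber D.f 5 (191 * 241) ψ ≠ 0)
    (V : WeierstrassCurve ℚ) [V.IsElliptic] [V.IsGloballyMinimal] [hp : Fact (5 : ℕ).Prime]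
    (C : VariableChange ℚ) (hCV : C • W.quadraticTwist 5 = V) :
    QuadraticBranchPlusEtaLowerInclusionAt V 5 ∧
      ((∀ m : ℕ, V.HasSurjectiveModNGaloisRep (5 ^ m : ℕ)) → QuadraticBranchPlusEtaMainConjectureAt V 5) := by
  haveI : W.IsElliptic := hW ▸ PlusEtaR0Kurihara.isElliptic_v137775i1
  exact etaPair_of_localTorsion W C (by norm_num) hCV fun ht0 ↦
    PlusEtaR0KuriharaK.etaPair_r0_kurK_v137775i1_5 hKim h300 W hW D hopt ht0 hδ V C hCV

/-- **Record r0 row `211600eb1`, `ht0` DISCHARGED**: the landed `PlusEtaR0KuriharaK.etaPair_r0_kurK_v211600eb1_5` with its local binder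
`ht0 : #W(ℚ_5)[5] = 1` supplied by `natCard_localPTorsion_eq_one_of_twist_of_supersingular` inside the
nodes; trust base now {`hKim`, `h300`, `hopt`, `hδ`}. For EVERY model `V` of `W^{(5)}`: (E⁺_η) at `5`,
(C1⁺_η) under the onto tower. CONDITIONAL; per-row instance; nothing booked; `BSD(W,5)` not claimed.
[cite: Kim2022StructureSelmer, Thm. 1.11 (PDF p. 8), Prop. 3.2 (PDF p. 15)] [cite: Kobayashi2003, §4 (p. 8)] -/
theorem etaPair_r0_kurK_v211600eb1_5
    (hKim : Kim2026.thm111_etaEisensteinInclusion_of_kuriharaNumber_ne_zero)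
    (h300 : cremona_abs_maninConstant_eq_one_of_level_le_300000)
    (W : WeierstrassCurve ℚ) (hW : W = ⟨0, 0, 0, -727375, -238777375⟩)
    (D : ModularParametrizationData W 211600)
    (hopt : ∀ z ∈ D.L.lattice, ∃ w ∈ periodLattice D.f, z = D.c * w)
    (hδ : ∃ ψ : (ℓ : ℕ) → (ZMod ℓ)ˣ →* Multiplicative (ZMod 5),
      (∀ ℓ ∈ (31 * 211 : ℕ).primeFactors, Function.Surjective (ψ ℓ)) ∧ kuriharaNumber D.f 5 (31 * 211) ψ ≠ 0)
    (V : WeierstrassCurve ℚ) [V.IsElliptic] [V.IsGloballyMinimal] [hp : Fact (5 : ℕ).Prime]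
    (C : VariableChange ℚ) (hCV : C • W.quadraticTwist 5 = V) :
    QuadraticBranchPlusEtaLowerInclusionAt V 5 ∧
      ((∀ m : ℕ, V.HasSurjectiveModNGaloisRep (5 ^ m : ℕ)) → QuadraticBranchPlusEtaMainConjectureAt V 5) := by
  haveI : W.IsElliptic := hW ▸ PlusEtaR0Kurihara.isElliptic_v211600eb1
  exact etaPair_of_localTorsion W C (by norm_num) hCV fun ht0 ↦
    PlusEtaR0KuriharaK.etaPair_r0_kurK_v211600eb1_5 hKim h300 W hW D hopt ht0 hδ V C hCV

/-- **Record r0 row `218450n1`, `ht0` DISCHARGED**: the landed `PlusEtaR0KuriharaK.etaPair_r0_kurK_v218450n1_5` with its local binder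
`ht0 : #W(ℚ_5)[5] = 1` supplied by `natCard_localPTorsion_eq_one_of_twist_of_supersingular` inside the
nodes; trust base now {`hKim`, `h300`, `hopt`, `hδ`}. For EVERY model `V` of `W^{(5)}`: (E⁺_η) at `5`,
(C1⁺_η) under the onto tower. CONDITIONAL; per-row instance; nothing booked; `BSD(W,5)` not claimed.
[cite: Kim2022StructureSelmer, Thm. 1.11 (PDF p. 8), Prop. 3.2 (PDF p. 15)] [cite: Kobayashi2003, §4 (p. 8)] -/
theorem etaPair_r0_kurK_v218450n1_5
    (hKim : Kim2026.thm111_etaEisensteinInclusion_of_kuriharaNumber_ne_zero)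
    (h300 : cremona_abs_maninConstant_eq_one_of_level_le_300000)
    (W : WeierstrassCurve ℚ) (hW : W = ⟨1, 1, 0, -87757200, -212324320000⟩)
    (D : ModularParametrizationData W 218450)
    (hopt : ∀ z ∈ D.L.lattice, ∃ w ∈ periodLattice D.f, z = D.c * w)
    (hδ : ∃ ψ : (ℓ : ℕ) → (ZMod ℓ)ˣ →* Multiplicative (ZMod 5),
      (∀ ℓ ∈ (71 * 421 : ℕ).primeFactors, Function.Surjective (ψ ℓ)) ∧ kuriharaNumber D.f 5 (71 * 421) ψ ≠ 0)
    (V : WeierstrassCurve ℚ) [V.IsElliptic] [V.IsGloballyMinimal] [hp : Fact (5 : ℕ).Prime]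
    (C : VariableChange ℚ) (hCV : C • W.quadraticTwist 5 = V) :
    QuadraticBranchPlusEtaLowerInclusionAt V 5 ∧
      ((∀ m : ℕ, V.HasSurjectiveModNGaloisRep (5 ^ m : ℕ)) → QuadraticBranchPlusEtaMainConjectureAt V 5) := by
  haveI : W.IsElliptic := hW ▸ PlusEtaR0Kurihara.isElliptic_v218450n1
  exact etaPair_of_localTorsion W C (by norm_num) hCV fun ht0 ↦
    PlusEtaR0KuriharaK.etaPair_r0_kurK_v218450n1_5 hKim h300 W hW D hopt ht0 hδ V C hCV

/-- **Record r0 row `291525bp1`, `ht0` DISCHARGED**: the landed `PlusEtaR0KuriharaK.etaPair_r0_kurK_v291525bp1_5` with its local binder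
`ht0 : #W(ℚ_5)[5] = 1` supplied by `natCard_localPTorsion_eq_one_of_twist_of_supersingular` inside the
nodes; trust base now {`hKim`, `h300`, `hopt`, `hδ`}. For EVERY model `V` of `W^{(5)}`: (E⁺_η) at `5`,
(C1⁺_η) under the onto tower. CONDITIONAL; per-row instance; nothing booked; `BSD(W,5)` not claimed.
[cite: Kim2022StructureSelmer, Thm. 1.11 (PDF p. 8), Prop. 3.2 (PDF p. 15)] [cite: Kobayashi2003, §4 (p. 8)] -/
theorem etaPair_r0_kurK_v291525bp1_5
    (hKim : Kim2026.thm111_etaEisensteinInclusion_of_kuriharaNumber_ne_zero)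
    (h300 : cremona_abs_maninConstant_eq_one_of_level_le_300000)
    (W : WeierstrassCurve ℚ) (hW : W = ⟨1, 1, 0, 552986925, -16404886620000⟩)
    (D : ModularParametrizationData W 291525)
    (hopt : ∀ z ∈ D.L.lattice, ∃ w ∈ periodLattice D.f, z = D.c * w)
    (hδ : ∃ ψ : (ℓ : ℕ) → (ZMod ℓ)ˣ →* Multiplicative (ZMod 5),
      (∀ ℓ ∈ (71 * 241 : ℕ).primeFactors, Function.Surjective (ψ ℓ)) ∧ kuriharaNumber D.f 5 (71 * 241) ψ ≠ 0)
    (V : WeierstrassCurve ℚ) [V.IsElliptic] [V.IsGloballyMinimal] [hp : Fact (5 : ℕ).Prime]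
    (C : VariableChange ℚ) (hCV : C • W.quadraticTwist 5 = V) :
    QuadraticBranchPlusEtaLowerInclusionAt V 5 ∧
      ((∀ m : ℕ, V.HasSurjectiveModNGaloisRep (5 ^ m : ℕ)) → QuadraticBranchPlusEtaMainConjectureAt V 5) := by
  haveI : W.IsElliptic := hW ▸ PlusEtaR0Kurihara.isElliptic_v291525bp1
  exact etaPair_of_localTorsion W C (by norm_num) hCV fun ht0 ↦
    PlusEtaR0KuriharaK.etaPair_r0_kurK_v291525bp1_5 hKim h300 W hW D hopt ht0 hδ V C hCV

/-- **Record r0 row `296400do1`, `ht0` DISCHARGED**: the landed `PlusEtaR0KuriharaK.etaPair_r0_kurK_v296400do1_5` with its local binder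
`ht0 : #W(ℚ_5)[5] = 1` supplied by `natCard_localPTorsion_eq_one_of_twist_of_supersingular` inside the
nodes; trust base now {`hKim`, `h300`, `hopt`, `hδ`}. For EVERY model `V` of `W^{(5)}`: (E⁺_η) at `5`,
(C1⁺_η) under the onto tower. CONDITIONAL; per-row instance; nothing booked; `BSD(W,5)` not claimed.
[cite: Kim2022StructureSelmer, Thm. 1.11 (PDF p. 8), Prop. 3.2 (PDF p. 15)] [cite: Kobayashi2003, §4 (p. 8)] -/
theorem etaPair_r0_kurK_v296400do1_5
    (hKim : Kim2026.thm111_etaEisensteinInclusion_of_kuriharaNumber_ne_zero)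
    (h300 : cremona_abs_maninConstant_eq_one_of_level_le_300000)
    (W : WeierstrassCurve ℚ) (hW : W = ⟨0, -1, 0, -13954083, -20049074838⟩)
    (D : ModularParametrizationData W 296400)
    (hopt : ∀ z ∈ D.L.lattice, ∃ w ∈ periodLattice D.f, z = D.c * w)
    (hδ : ∃ ψ : (ℓ : ℕ) → (ZMod ℓ)ˣ →* Multiplicative (ZMod 5),
      (∀ ℓ ∈ (11 * 401 : ℕ).primeFactors, Function.Surjective (ψ ℓ)) ∧ kuriharaNumber D.f 5 (11 * 401) ψ ≠ 0)
    (V : WeierstrassCurve ℚ) [V.IsElliptic] [V.IsGloballyMinimal] [hp : Fact (5 : ℕ).Prime]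
    (C : VariableChange ℚ) (hCV : C • W.quadraticTwist 5 = V) :
    QuadraticBranchPlusEtaLowerInclusionAt V 5 ∧
      ((∀ m : ℕ, V.HasSurjectiveModNGaloisRep (5 ^ m : ℕ)) → QuadraticBranchPlusEtaMainConjectureAt V 5) := by
  haveI : W.IsElliptic := hW ▸ PlusEtaR0Kurihara.isElliptic_v296400do1
  exact etaPair_of_localTorsion W C (by norm_num) hCV fun ht0 ↦
    PlusEtaR0KuriharaK.etaPair_r0_kurK_v296400do1_5 hKim h300 W hW D hopt ht0 hδ V C hCV

/-- **Record r0 row `302050f1`, `ht0` DISCHARGED**: the landed `PlusEtaR0KuriharaK.etaPair_r0_kurK_v302050f1_5` with its local binder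
`ht0 : #W(ℚ_5)[5] = 1` supplied by `natCard_localPTorsion_eq_one_of_twist_of_supersingular` inside the
nodes; trust base now {`hKim`, `h500`, `hopt`, `hδ`}. For EVERY model `V` of `W^{(5)}`: (E⁺_η) at `5`,
(C1⁺_η) under the onto tower. CONDITIONAL; per-row instance; nothing booked; `BSD(W,5)` not claimed.
[cite: Kim2022StructureSelmer, Thm. 1.11 (PDF p. 8), Prop. 3.2 (PDF p. 15)] [cite: Kobayashi2003, §4 (p. 8)] -/
theorem etaPair_r0_kurK_v302050f1_5
    (hKim : Kim2026.thm111_etaEisensteinInclusion_of_kuriharaNumber_ne_zero)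
    (h500 : cremona_abs_maninConstant_eq_one_of_level_lt_500000)
    (W : WeierstrassCurve ℚ) (hW : W = ⟨1, -1, 0, -1070242, -455679084⟩)
    (D : ModularParametrizationData W 302050)
    (hopt : ∀ z ∈ D.L.lattice, ∃ w ∈ periodLattice D.f, z = D.c * w)
    (hδ : ∃ ψ : (ℓ : ℕ) → (ZMod ℓ)ˣ →* Multiplicative (ZMod 5),
      (∀ ℓ ∈ (241 * 251 : ℕ).primeFactors, Function.Surjective (ψ ℓ)) ∧ kuriharaNumber D.f 5 (241 * 251) ψ ≠ 0)
    (V : WeierstrassCurve ℚ) [V.IsElliptic] [V.IsGloballyMinimal] [hp : Fact (5 : ℕ).Prime]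
    (C : VariableChange ℚ) (hCV : C • W.quadraticTwist 5 = V) :
    QuadraticBranchPlusEtaLowerInclusionAt V 5 ∧
      ((∀ m : ℕ, V.HasSurjectiveModNGaloisRep (5 ^ m : ℕ)) → QuadraticBranchPlusEtaMainConjectureAt V 5) := by
  haveI : W.IsElliptic := hW ▸ PlusEtaR0Kurihara.isElliptic_v302050f1
  exact etaPair_of_localTorsion W C (by norm_num) hCV fun ht0 ↦
    PlusEtaR0KuriharaK.etaPair_r0_kurK_v302050f1_5 hKim h500 W hW D hopt ht0 hδ V C hCV

/-- **Record r0 row `333975m1`, `ht0` DISCHARGED**: the landed `PlusEtaR0KuriharaK.etaPair_r0_kurK_v333975m1_5` with its local binder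
`ht0 : #W(ℚ_5)[5] = 1` supplied by `natCard_localPTorsion_eq_one_of_twist_of_supersingular` inside the
nodes; trust base now {`hKim`, `h500`, `hopt`, `hδ`}. For EVERY model `V` of `W^{(5)}`: (E⁺_η) at `5`,
(C1⁺_η) under the onto tower. CONDITIONAL; per-row instance; nothing booked; `BSD(W,5)` not claimed.
[cite: Kim2022StructureSelmer, Thm. 1.11 (PDF p. 8), Prop. 3.2 (PDF p. 15)] [cite: Kobayashi2003, §4 (p. 8)] -/
theorem etaPair_r0_kurK_v333975m1_5
    (hKim : Kim2026.thm111_etaEisensteinInclusion_of_kuriharaNumber_ne_zero)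
    (h500 : cremona_abs_maninConstant_eq_one_of_level_lt_500000)
    (W : WeierstrassCurve ℚ) (hW : W = ⟨1, 1, 0, -754087075, -7970717378000⟩)
    (D : ModularParametrizationData W 333975)
    (hopt : ∀ z ∈ D.L.lattice, ∃ w ∈ periodLattice D.f, z = D.c * w)
    (hδ : ∃ ψ : (ℓ : ℕ) → (ZMod ℓ)ˣ →* Multiplicative (ZMod 5),
      (∀ ℓ ∈ (101 * 241 : ℕ).primeFactors, Function.Surjective (ψ ℓ)) ∧ kuriharaNumber D.f 5 (101 * 241) ψ ≠ 0)
    (V : WeierstrassCurve ℚ) [V.IsElliptic] [V.IsGloballyMinimal] [hp : Fact (5 : ℕ).Prime]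
    (C : VariableChange ℚ) (hCV : C • W.quadraticTwist 5 = V) :
    QuadraticBranchPlusEtaLowerInclusionAt V 5 ∧
      ((∀ m : ℕ, V.HasSurjectiveModNGaloisRep (5 ^ m : ℕ)) → QuadraticBranchPlusEtaMainConjectureAt V 5) := by
  haveI : W.IsElliptic := hW ▸ PlusEtaR0Kurihara.isElliptic_v333975m1
  exact etaPair_of_localTorsion W C (by norm_num) hCV fun ht0 ↦
    PlusEtaR0KuriharaK.etaPair_r0_kurK_v333975m1_5 hKim h500 W hW D hopt ht0 hδ V C hCV

/-- **Record r0 row `444900i1`, `ht0` DISCHARGED**: the landed `PlusEtaR0KuriharaK.etaPair_r0_kurK_v444900i1_5` with its local binder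
`ht0 : #W(ℚ_5)[5] = 1` supplied by `natCard_localPTorsion_eq_one_of_twist_of_supersingular` inside the
nodes; trust base now {`hKim`, `h500`, `hopt`, `hδ`}. For EVERY model `V` of `W^{(5)}`: (E⁺_η) at `5`,
(C1⁺_η) under the onto tower. CONDITIONAL; per-row instance; nothing booked; `BSD(W,5)` not claimed.
[cite: Kim2022StructureSelmer, Thm. 1.11 (PDF p. 8), Prop. 3.2 (PDF p. 15)] [cite: Kobayashi2003, §4 (p. 8)] -/
theorem etaPair_r0_kurK_v444900i1_5
    (hKim : Kim2026.thm111_etaEisensteinInclusion_of_kuriharaNumber_ne_zero)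
    (h500 : cremona_abs_maninConstant_eq_one_of_level_lt_500000)
    (W : WeierstrassCurve ℚ) (hW : W = ⟨0, 1, 0, -12333, -534912⟩)
    (D : ModularParametrizationData W 444900)
    (hopt : ∀ z ∈ D.L.lattice, ∃ w ∈ periodLattice D.f, z = D.c * w)
    (hδ : ∃ ψ : (ℓ : ℕ) → (ZMod ℓ)ˣ →* Multiplicative (ZMod 5),
      (∀ ℓ ∈ (101 * 691 : ℕ).primeFactors, Function.Surjective (ψ ℓ)) ∧ kuriharaNumber D.f 5 (101 * 691) ψ ≠ 0)
    (V : WeierstrassCurve ℚ) [V.IsElliptic] [V.IsGloballyMinimal] [hp : Fact (5 : ℕ).Prime]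
    (C : VariableChange ℚ) (hCV : C • W.quadraticTwist 5 = V) :
    QuadraticBranchPlusEtaLowerInclusionAt V 5 ∧
      ((∀ m : ℕ, V.HasSurjectiveModNGaloisRep (5 ^ m : ℕ)) → QuadraticBranchPlusEtaMainConjectureAt V 5) := by
  haveI : W.IsElliptic := hW ▸ PlusEtaR0Kurihara.isElliptic_v444900i1
  exact etaPair_of_localTorsion W C (by norm_num) hCV fun ht0 ↦
    PlusEtaR0KuriharaK.etaPair_r0_kurK_v444900i1_5 hKim h500 W hW D hopt ht0 hδ V C hCV

/-- **Record r0 row `449650br1`, `ht0` DISCHARGED**: the landed `PlusEtaR0KuriharaK.etaPair_r0_kurK_v449650br1_5` with its local binder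
`ht0 : #W(ℚ_5)[5] = 1` supplied by `natCard_localPTorsion_eq_one_of_twist_of_supersingular` inside the
nodes; trust base now {`hKim`, `h500`, `hopt`, `hδ`}. For EVERY model `V` of `W^{(5)}`: (E⁺_η) at `5`,
(C1⁺_η) under the onto tower. CONDITIONAL; per-row instance; nothing booked; `BSD(W,5)` not claimed.
[cite: Kim2022StructureSelmer, Thm. 1.11 (PDF p. 8), Prop. 3.2 (PDF p. 15)] [cite: Kobayashi2003, §4 (p. 8)] -/
theorem etaPair_r0_kurK_v449650br1_5
    (hKim : Kim2026.thm111_etaEisensteinInclusion_of_kuriharaNumber_ne_zero)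
    (h500 : cremona_abs_maninConstant_eq_one_of_level_lt_500000)
    (W : WeierstrassCurve ℚ) (hW : W = ⟨1, 1, 0, -1311298700, 18276259058000⟩)
    (D : ModularParametrizationData W 449650)
    (hopt : ∀ z ∈ D.L.lattice, ∃ w ∈ periodLattice D.f, z = D.c * w)
    (hδ : ∃ ψ : (ℓ : ℕ) → (ZMod ℓ)ˣ →* Multiplicative (ZMod 5),
      (∀ ℓ ∈ (11 * 71 : ℕ).primeFactors, Function.Surjective (ψ ℓ)) ∧ kuriharaNumber D.f 5 (11 * 71) ψ ≠ 0)
    (V : WeierstrassCurve ℚ) [V.IsElliptic] [V.IsGloballyMinimal] [hp : Fact (5 : ℕ).Prime]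
    (C : VariableChange ℚ) (hCV : C • W.quadraticTwist 5 = V) :
    QuadraticBranchPlusEtaLowerInclusionAt V 5 ∧
      ((∀ m : ℕ, V.HasSurjectiveModNGaloisRep (5 ^ m : ℕ)) → QuadraticBranchPlusEtaMainConjectureAt V 5) := by
  haveI : W.IsElliptic := hW ▸ PlusEtaR0Kurihara.isElliptic_v449650br1
  exact etaPair_of_localTorsion W C (by norm_num) hCV fun ht0 ↦
    PlusEtaR0KuriharaK.etaPair_r0_kurK_v449650br1_5 hKim h500 W hW D hopt ht0 hδ V C hCV

/-- **Record r0 row `414150cd1`, `ht0` DISCHARGED**: the landed `PlusEtaR0KuriharaK.etaPair_r0_kurK_v414150cd1_5` with its local binder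
`ht0 : #W(ℚ_5)[5] = 1` supplied by `natCard_localPTorsion_eq_one_of_twist_of_supersingular` inside the
nodes; trust base now {`hKim`, `h500`, `hopt`, `hδ`}. For EVERY model `V` of `W^{(5)}`: (E⁺_η) at `5`,
(C1⁺_η) under the onto tower. CONDITIONAL; per-row instance; nothing booked; `BSD(W,5)` not claimed.
[cite: Kim2022StructureSelmer, Thm. 1.11 (PDF p. 8), Prop. 3.2 (PDF p. 15)] [cite: Kobayashi2003, §4 (p. 8)] -/
theorem etaPair_r0_kurK_v414150cd1_5
    (hKim : Kim2026.thm111_etaEisensteinInclusion_of_kuriharaNumber_ne_zero)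
    (h500 : cremona_abs_maninConstant_eq_one_of_level_lt_500000)
    (W : WeierstrassCurve ℚ) (hW : W = ⟨1, 1, 1, -1875818638, 31269686593031⟩)
    (D : ModularParametrizationData W 414150)
    (hopt : ∀ z ∈ D.L.lattice, ∃ w ∈ periodLattice D.f, z = D.c * w)
    (hδ : ∃ ψ : (ℓ : ℕ) → (ZMod ℓ)ˣ →* Multiplicative (ZMod 5),
      (∀ ℓ ∈ (191 * 751 : ℕ).primeFactors, Function.Surjective (ψ ℓ)) ∧ kuriharaNumber D.f 5 (191 * 751) ψ ≠ 0)
    (V : WeierstrassCurve ℚ) [V.IsElliptic] [V.IsGloballyMinimal] [hp : Fact (5 : ℕ).Prime]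
    (C : VariableChange ℚ) (hCV : C • W.quadraticTwist 5 = V) :
    QuadraticBranchPlusEtaLowerInclusionAt V 5 ∧
      ((∀ m : ℕ, V.HasSurjectiveModNGaloisRep (5 ^ m : ℕ)) → QuadraticBranchPlusEtaMainConjectureAt V 5) := by
  haveI : W.IsElliptic := hW ▸ PlusEtaR0Kurihara.isElliptic_v414150cd1
  exact etaPair_of_localTorsion W C (by norm_num) hCV fun ht0 ↦
    PlusEtaR0KuriharaK.etaPair_r0_kurK_v414150cd1_5 hKim h500 W hW D hopt ht0 hδ V C hCV

/-- **Record r0 row `254310t1` @7, `ht0` DISCHARGED**: the landed `PlusEtaR0KuriharaK.etaPair_r0_kurK_v254310t1_7` with its local binder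
`ht0 : #W(ℚ_7)[7] = 1` supplied by `natCard_localPTorsion_eq_one_of_twist_of_supersingular` inside the
nodes; trust base now {`hKim`, `h300`, `hopt`, `hδ`}. For EVERY model `V` of `W^{(-7)}`: (E⁺_η) at `7`,
(C1⁺_η) under the onto tower. CONDITIONAL; per-row instance; nothing booked; `BSD(W,7)` not claimed.
[cite: Kim2022StructureSelmer, Thm. 1.11 (PDF p. 8), Prop. 3.2 (PDF p. 15)] [cite: Kobayashi2003, §4 (p. 8)] -/
theorem etaPair_r0_kurK_v254310t1_7
    (hKim : Kim2026.thm111_etaEisensteinInclusion_of_kuriharaNumber_ne_zero)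
    (h300 : cremona_abs_maninConstant_eq_one_of_level_le_300000)
    (W : WeierstrassCurve ℚ) (hW : W = ⟨1, 1, 0, -2001385817, -34515694574619⟩)
    (D : ModularParametrizationData W 254310)
    (hopt : ∀ z ∈ D.L.lattice, ∃ w ∈ periodLattice D.f, z = D.c * w)
    (hδ : ∃ ψ : (ℓ : ℕ) → (ZMod ℓ)ˣ →* Multiplicative (ZMod 7),
      (∀ ℓ ∈ (127 * 449 : ℕ).primeFactors, Function.Surjective (ψ ℓ)) ∧ kuriharaNumber D.f 7 (127 * 449) ψ ≠ 0)
    (V : WeierstrassCurve ℚ) [V.IsElliptic] [V.IsGloballyMinimal] [hp : Fact (7 : ℕ).Prime]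
    (C : VariableChange ℚ) (hCV : C • W.quadraticTwist (-7) = V) :
    QuadraticBranchPlusEtaLowerInclusionAt V 7 ∧
      ((∀ m : ℕ, V.HasSurjectiveModNGaloisRep (7 ^ m : ℕ)) → QuadraticBranchPlusEtaMainConjectureAt V 7) := by
  haveI : W.IsElliptic := hW ▸ PlusEtaR0Kurihara.isElliptic_v254310t1
  exact etaPair_of_localTorsion W C (by norm_num) hCV fun ht0 ↦
    PlusEtaR0KuriharaK.etaPair_r0_kurK_v254310t1_7 hKim h300 W hW D hopt ht0 hδ V C hCV

/-- **Record r0 row `141512r1` @7, `ht0` DISCHARGED**: the landed `PlusEtaR0KuriharaK.etaPair_r0_kurK_v141512r1_7` with its local binder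
`ht0 : #W(ℚ_7)[7] = 1` supplied by `natCard_localPTorsion_eq_one_of_twist_of_supersingular` inside the
nodes; trust base now {`hKim`, `h300`, `hopt`, `hδ`}. For EVERY model `V` of `W^{(-7)}`: (E⁺_η) at `7`,
(C1⁺_η) under the onto tower. CONDITIONAL; per-row instance; nothing booked; `BSD(W,7)` not claimed.
[cite: Kim2022StructureSelmer, Thm. 1.11 (PDF p. 8), Prop. 3.2 (PDF p. 15)] [cite: Kobayashi2003, §4 (p. 8)] -/
theorem etaPair_r0_kurK_v141512r1_7
    (hKim : Kim2026.thm111_etaEisensteinInclusion_of_kuriharaNumber_ne_zero)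
    (h300 : cremona_abs_maninConstant_eq_one_of_level_le_300000)
    (W : WeierstrassCurve ℚ) (hW : W = ⟨0, 1, 0, -2128576, -2202603488⟩)
    (D : ModularParametrizationData W 141512)
    (hopt : ∀ z ∈ D.L.lattice, ∃ w ∈ periodLattice D.f, z = D.c * w)
    (hδ : ∃ ψ : (ℓ : ℕ) → (ZMod ℓ)ˣ →* Multiplicative (ZMod 7),
      (∀ ℓ ∈ (449 * 491 : ℕ).primeFactors, Function.Surjective (ψ ℓ)) ∧ kuriharaNumber D.f 7 (449 * 491) ψ ≠ 0)
    (V : WeierstrassCurve ℚ) [V.IsElliptic] [V.IsGloballyMinimal] [hp : Fact (7 : ℕ).Prime]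
    (C : VariableChange ℚ) (hCV : C • W.quadraticTwist (-7) = V) :
    QuadraticBranchPlusEtaLowerInclusionAt V 7 ∧
      ((∀ m : ℕ, V.HasSurjectiveModNGaloisRep (7 ^ m : ℕ)) → QuadraticBranchPlusEtaMainConjectureAt V 7) := by
  haveI : W.IsElliptic := hW ▸ PlusEtaR0Kurihara.isElliptic_v141512r1
  exact etaPair_of_localTorsion W C (by norm_num) hCV fun ht0 ↦
    PlusEtaR0KuriharaK.etaPair_r0_kurK_v141512r1_7 hKim h300 W hW D hopt ht0 hδ V C hCV

end Summit.BirchSwinnertonDyer.BirchSwinnertonDyer.Theorems.PlusEtaKuriharaT0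

end
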